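import Summits.Ventures.PercRepro.C026HubAttachB

/-!
# Hub attachment and the D-free inequality, III: the projection (p5, gen 10)

**`hConnAvoid_iff_aug`** — for `ω ∈ bot`, `X` a union of `ω`-clusters not containing `c`, and non-hubs
`x, y`: `x ~_H y` avoiding `X` in `ω` iff `x` and `y` are joined by the augmented relation `AugAdj`
of `C026HubAttachB.lean`.  The proof walks along the H-walk keeping, at a hub `z`, the augmented
reachability of every mark `t` that is an H-neighbour of `z` (the hub's *anchors*):
`reach_anchor_of_notMem_M` (a hub outside `M`, in the cluster of a mark `m`: its other anchor is `c`,
through `SigM m`) and `reach_anchor_of_mem_M` (a hub inside `M`: the other mark through `c` — mixed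
star, `SigM m ∧ SigM t` — or directly, all `c`-edges open, `SigLink`).
-/

namespace PercRepro

namespace MultiGraph

variable {V E : Type*} {G : MultiGraph V E}

section Walk

variable {Hs : Set V} {a b c : V} {ω : Config E} (hH : G.IsHubSet Hs a b c) (hbot : G.IsBot ω a b c)
include hH hbot

/-! ### The projection: H-walks of `ω` are augmented walks of the base -/

/-- An augmented step `z → m` for non-hubs `z, m` outside `M` and `X`, connected in `ω`. -/
theorem IsHubSet.augAdj_of_conn {X : Set V} {z m : V} (hz : z ∉ Hs) (hm : m ∉ Hs) (hzX : z ∉ X)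
    (hmX : m ∉ X) (hzM : z ∉ G.cluster ω c) (hmM : m ∉ G.cluster ω c) (hconn : G.Conn ω z m) :
    G.AugAdj Hs X ω a b c z m :=
  Or.inl ⟨hz, hm, hzX, hmX, Or.inr (Or.inr ⟨fun h => hzM ((hH.mem_M_iff_base hbot hz).2 h),
    fun h => hmM ((hH.mem_M_iff_base hbot hm).2 h),
    (hH.conn_iff_base' hbot.singleDir hz hm).1 hconn⟩)⟩

omit hH hbot in
/-- The virtual edge `c – m` for `m ∈ {a, b}` with `SigM m`. -/
theorem augAdj_sigM {X : Set V} (hXc : c ∉ X) {m : V} (hm : m = a ∨ m = b) (hmX : m ∉ X)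
    (hs : G.SigM Hs X ω m c) : G.AugAdj Hs X ω a b c c m ∧ G.AugAdj Hs X ω a b c m c := by
  rcases hm with rfl | rfl
  · exact ⟨Or.inr ⟨hXc, hmX, Or.inl ⟨hs, Or.inl ⟨rfl, rfl⟩⟩⟩,
      Or.inr ⟨hmX, hXc, Or.inl ⟨hs, Or.inr ⟨rfl, rfl⟩⟩⟩⟩
  · exact ⟨Or.inr ⟨hXc, hmX, Or.inr (Or.inl ⟨hs, Or.inl ⟨rfl, rfl⟩⟩)⟩,
      Or.inr ⟨hmX, hXc, Or.inr (Or.inl ⟨hs, Or.inr ⟨rfl, rfl⟩⟩)⟩⟩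

omit hH hbot in
/-- The virtual link `a – b` with `SigLink`. -/
theorem augAdj_sigLink {X : Set V} (haX : a ∉ X) (hbX : b ∉ X) (hs : G.SigLink Hs X ω a b c) :
    G.AugAdj Hs X ω a b c a b ∧ G.AugAdj Hs X ω a b c b a :=
  ⟨Or.inr ⟨haX, hbX, Or.inr (Or.inr ⟨hs, Or.inl ⟨rfl, rfl⟩⟩)⟩,
    Or.inr ⟨hbX, haX, Or.inr (Or.inr ⟨hs, Or.inr ⟨rfl, rfl⟩⟩)⟩⟩

/-- **From a hub outside `M` in state `m` (open to `m ≠ c`), with `x` augmented-joined to `m`,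
every anchor of the hub is augmented-reachable**: the other anchor is `c`, through the hub's closed
`c`-edge (`SigM m`). -/
theorem IsHubSet.reach_anchor_of_notMem_M {X : Set V} (hXc : c ∉ X) {x h : V} (hh : h ∈ Hs)
    (hhX : h ∉ X) (hhM : h ∉ G.cluster ω c) {m : V} (hm : m = a ∨ m = b) (hmX : m ∉ X)
    (hopen : G.OpenTo ω h m) (hxm : Relation.ReflTransGen (G.AugAdj Hs X ω a b c) x m) {t : V}
    (ht : t = a ∨ t = b ∨ t = c) (hadj : G.HAdj ω c h t) :
    Relation.ReflTransGen (G.AugAdj Hs X ω a b c) x t := by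
  rcases hH.anchor_of_notMem_M hbot hh hhM hm hopen ht hadj with rfl | ⟨rfl, hcl⟩
  · exact hxm
  · exact hxm.tail (augAdj_sigM hXc hm hmX ⟨h, hh, hhX, Or.inl ⟨hopen, hcl⟩⟩).2

/-- **From a hub inside `M` (open to `c`) with an edge to the mark `m ≠ c`, with `x`
augmented-joined to `m` and `t ∉ X` an anchor of the hub, `t` is augmented-reachable**: `t = m`, or
`t = c` through a closed `c`-edge (`SigM m`), or `t` is the other mark, through `c` (mixed star:
`SigM m` and `SigM t`) or directly (all `c`-edges open: `SigLink`). -/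
theorem IsHubSet.reach_anchor_of_mem_M {X : Set V} (hXc : c ∉ X) {x h : V} (hh : h ∈ Hs)
    (hhX : h ∉ X) (hopenc : G.OpenTo ω h c) {m : V} (hm : m = a ∨ m = b) (hmX : m ∉ X)
    (hedge : G.HasEdge h m) (hxm : Relation.ReflTransGen (G.AugAdj Hs X ω a b c) x m) {t : V}
    (ht : t = a ∨ t = b ∨ t = c) (htX : t ∉ X) (hadj : G.HAdj ω c h t) :
    Relation.ReflTransGen (G.AugAdj Hs X ω a b c) x t := by
  have hhM : h ∈ G.cluster ω c := (hH.hub_mem_M_iff hbot hh).2 hopenc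
  rcases hbot.anchor_of_mem_M hhM ht hadj with ⟨rfl, hcl⟩ | ⟨htc, hedget⟩
  · exact hxm.tail (augAdj_sigM hXc hm hmX ⟨h, hh, hhX, Or.inr ⟨hopenc, hcl, hedge⟩⟩).2
  · by_cases htm : t = m
    · exact htm ▸ hxm
    · -- `t` is the other mark
      have hmt : (m = a ∧ t = b) ∨ (m = b ∧ t = a) := by
        rcases hm with rfl | rfl <;> rcases ht with rfl | rfl | rfl
        · exact (htm rfl).elim
        · exact Or.inl ⟨rfl, rfl⟩
        · exact (htc rfl).elim
        · exact Or.inr ⟨rfl, rfl⟩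
        · exact (htm rfl).elim
        · exact (htc rfl).elim
      by_cases hcl : G.ClosedTo ω h c
      · -- mixed star: `m – c – t`
        have h1 := (augAdj_sigM hXc hm hmX ⟨h, hh, hhX, Or.inr ⟨hopenc, hcl, hedge⟩⟩).2
        have ht' : t = a ∨ t = b := by
          rcases hmt with ⟨-, rfl⟩ | ⟨-, rfl⟩
          · exact Or.inr rfl
          · exact Or.inl rfl
        have h2 := (augAdj_sigM hXc ht' htX ⟨h, hh, hhX, Or.inr ⟨hopenc, hcl, hedget⟩⟩).1
        exact (hxm.tail h1).tail h2
      · -- all `c`-edges open: the link `a – b`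
        have hlink : G.SigLink Hs X ω a b c := by
          rcases hmt with ⟨rfl, rfl⟩ | ⟨rfl, rfl⟩
          · exact ⟨h, hh, hhX, hopenc, hcl, hedge, hedget⟩
          · exact ⟨h, hh, hhX, hopenc, hcl, hedget, hedge⟩
        rcases hmt with ⟨rfl, rfl⟩ | ⟨rfl, rfl⟩
        · exact hxm.tail (augAdj_sigLink hmX htX hlink).1
        · exact hxm.tail (augAdj_sigLink htX hmX hlink).2

/-- **The projection**: for `ω ∈ bot`, `X` a union of `ω`-clusters with `c ∉ X`, and non-hubs
`x, y`: an H-walk from `x` to `y` avoiding `X` yields an augmented walk. -/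
theorem IsHubSet.rtg_aug_of_hConnAvoid {X : Set V} (hXc : c ∉ X)
    (hXcl : ∀ u v, G.Conn ω u v → (u ∈ X ↔ v ∈ X)) {x y : V} (hx : x ∉ Hs) (hy : y ∉ Hs)
    (hwalk : G.HConnAvoid ω c X x y) : Relation.ReflTransGen (G.AugAdj Hs X ω a b c) x y := by
  -- the invariant: a non-hub is augmented-reachable; at a hub, every anchor outside `X` is
  suffices key : ∀ z, G.HConnAvoid ω c X x z →
      (z ∉ Hs → Relation.ReflTransGen (G.AugAdj Hs X ω a b c) x z) ∧
        (z ∈ Hs → ∀ t, (t = a ∨ t = b ∨ t = c) → t ∉ X → G.HAdj ω c z t →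
          Relation.ReflTransGen (G.AugAdj Hs X ω a b c) x t) from
    (key y hwalk).1 hy
  intro z hz
  induction hz with
  | refl => exact ⟨fun _ => Relation.ReflTransGen.refl, fun hxH => (hx hxH).elim⟩
  | @tail z z' _ hstep ih =>
    obtain ⟨hadj, hzX, hz'X⟩ := hstep
    have hsd := hbot.singleDir (Hs := Hs)
    by_cases hzH : z ∈ Hs
    · -- from a hub `z`
      have ihz := ih.2 hzH
      refine ⟨fun hz'H => ?_, fun hz'H t ht htX hadj' => ?_⟩
      · -- to a non-hub `z'`
        by_cases hz'm : z' = a ∨ z' = b ∨ z' = c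
        · exact ihz z' hz'm hz'X hadj
        · -- a free step inside the cluster of a mark `m ≠ c`
          obtain ⟨hzM, hz'M, hconn⟩ := hH.hAdj_hub_nonmark hzH hz'm hadj
          obtain ⟨m, hm, hopen, hmz'⟩ := hH.conn_of_hub_notMem_M hbot hzH hzM
            (fun h => hz'H (by rw [h]; exact hzH)) hconn
          have hm' : m = a ∨ m = b ∨ m = c := hm.elim (fun h => Or.inl h) (fun h => Or.inr (Or.inl h))
          have hmH : m ∉ Hs := hH.mark_notMem hm'
          have hmX : m ∉ X := fun h => hz'X ((hXcl m z' hmz').1 h)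
          have hmM : m ∉ G.cluster ω c := fun h => by
            rcases hm with rfl | rfl
            · exact hbot.a_notMem_M h
            · exact hbot.b_notMem_M h
          have hxm := ihz m hm' hmX (Or.inr (Or.inr ⟨hzM, hmM, hopen.conn⟩))
          exact hxm.tail (hH.augAdj_of_conn hbot hmH hz'H hmX hz'X hmM hz'M hmz')
      · -- to a hub `z'`: a free step inside the cluster of a mark `m ≠ c`
        have hz'm : ¬ (z' = a ∨ z' = b ∨ z' = c) := fun h => hH.mark_notMem h hz'H
        obtain ⟨hzM, hz'M, hconn⟩ := hH.hAdj_hub_nonmark hzH hz'm hadj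
        by_cases hzz' : z' = z
        · subst hzz'
          exact ihz t ht htX hadj'
        · obtain ⟨m, hm, hopen, hmz'⟩ := hH.conn_of_hub_notMem_M hbot hzH hzM hzz' hconn
          have hm' : m = a ∨ m = b ∨ m = c := hm.elim (fun h => Or.inl h) (fun h => Or.inr (Or.inl h))
          have hmX : m ∉ X := fun h => hz'X ((hXcl m z' hmz').1 h)
          have hmM : m ∉ G.cluster ω c := fun h => by
            rcases hm with rfl | rfl
            · exact hbot.a_notMem_M h
            · exact hbot.b_notMem_M h
          have hxm := ihz m hm' hmX (Or.inr (Or.inr ⟨hzM, hmM, hopen.conn⟩))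
          have hopen' : G.OpenTo ω z' m := (hH.hub_conn_mark_iff hbot hz'H hm').1 hmz'
          exact hH.reach_anchor_of_notMem_M hbot hXc hz'H hz'X hz'M hm hmX hopen' hxm ht hadj'
    · -- from a non-hub `z`
      have hxz := ih.1 hzH
      refine ⟨fun hz'H => hxz.tail (Or.inl ⟨hzH, hz'H, hzX, hz'X,
        (hH.hAdj_nonhub_iff hbot hzH hz'H).1 hadj⟩), fun hz'H t ht htX hadj' => ?_⟩
      -- into a hub `z'`
      have hcM : c ∈ G.cluster ω c := c_mem_M ω c
      rcases hadj with ⟨hzM, hz'M, e, he, hj⟩ | ⟨hiff, e, hj⟩ | ⟨hzM, hz'M, hconn⟩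
      · -- internal H-edge: `z = c`, `z'` has a mixed `c`-star
        have hzm : z = a ∨ z = b ∨ z = c := hH.mark_of_link hz'H hj.link.symm
        have hzc : z = c := hbot.eq_c_of_mem_M hzm hzM
        subst hzc
        have hopenc : G.OpenTo ω z' z := (hH.hub_mem_M_iff hbot hz'H).1 hz'M
        have hcl : G.ClosedTo ω z' z := ⟨e, he, hj.link.symm⟩
        rcases hbot.anchor_of_mem_M hz'M ht hadj' with ⟨rfl, -⟩ | ⟨htc, hedget⟩
        · exact hxz
        · have ht' : t = a ∨ t = b := by
            rcases ht with rfl | rfl | rfl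
            · exact Or.inl rfl
            · exact Or.inr rfl
            · exact (htc rfl).elim
          exact hxz.tail (augAdj_sigM hXc ht' htX ⟨z', hz'H, hz'X, Or.inr ⟨hopenc, hcl, hedget⟩⟩).1
      · -- an edge `z – z'` with exactly one endpoint in `M`: `z` is a mark
        have hzm : z = a ∨ z = b ∨ z = c := hH.mark_of_link hz'H hj.link.symm
        by_cases hzc : z = c
        · -- `z = c ∈ M`, `z' ∉ M`: the edge is a closed `c`-edge of `z'`
          subst hzc
          have hz'M : z' ∉ G.cluster ω z := hiff.1 hcM
          have hnopen : ¬ G.OpenTo ω z' z := fun h => hz'M ((hH.hub_mem_M_iff hbot hz'H).2 h)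
          have hcl : G.ClosedTo ω z' z := closedTo_of_link_of_not_openTo hj.link.symm hnopen
          rcases hH.anchor_of_notMem_M' hbot hz'H hz'M ht hadj' with rfl | ⟨hm, hopen⟩
          · exact hxz
          · exact hxz.tail (augAdj_sigM hXc hm htX ⟨z', hz'H, hz'X, Or.inl ⟨hopen, hcl⟩⟩).1
        · -- `z ∈ {a, b}` outside `M`, `z' ∈ M`
          have hzM : z ∉ G.cluster ω c := fun h => hzc (hbot.eq_c_of_mem_M hzm h)
          have hz'M : z' ∈ G.cluster ω c := by
            by_contra h
            exact hzM (hiff.2 h)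
          have hopenc : G.OpenTo ω z' c := (hH.hub_mem_M_iff hbot hz'H).1 hz'M
          have hm : z = a ∨ z = b := by
            rcases hzm with h | h | h
            · exact Or.inl h
            · exact Or.inr h
            · exact (hzc h).elim
          exact hH.reach_anchor_of_mem_M hbot hXc hz'H hz'X hopenc hm hzX ⟨e, hj.link.symm⟩ hxz ht
            htX hadj'
      · -- a free step into a hub outside `M`: `z` lies in the cluster of a mark `m ≠ c`
        obtain ⟨m, hm, hopen, hmz⟩ := hH.conn_of_hub_notMem_M hbot hz'H hz'M
          (fun h => hzH (by rw [h]; exact hz'H)) hconn.symm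
        have hm' : m = a ∨ m = b ∨ m = c := hm.elim (fun h => Or.inl h) (fun h => Or.inr (Or.inl h))
        have hmH : m ∉ Hs := hH.mark_notMem hm'
        have hmX : m ∉ X := fun h => hzX ((hXcl m z hmz).1 h)
        have hmM : m ∉ G.cluster ω c := fun h => by
          rcases hm with rfl | rfl
          · exact hbot.a_notMem_M h
          · exact hbot.b_notMem_M h
        have hxm : Relation.ReflTransGen (G.AugAdj Hs X ω a b c) x m :=
          hxz.tail (hH.augAdj_of_conn hbot hzH hmH hzX hmX hzM hmM hmz.symm)
        exact hH.reach_anchor_of_notMem_M hbot hXc hz'H hz'X hz'M hm hmX hopen hxm ht hadj'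

/-- **H-walks avoiding `X` between non-hubs are exactly the augmented walks.** -/
theorem IsHubSet.hConnAvoid_iff_aug {X : Set V} (hXc : c ∉ X)
    (hXcl : ∀ u v, G.Conn ω u v → (u ∈ X ↔ v ∈ X)) {x y : V} (hx : x ∉ Hs) (hy : y ∉ Hs) :
    G.HConnAvoid ω c X x y ↔ Relation.ReflTransGen (G.AugAdj Hs X ω a b c) x y :=
  ⟨hH.rtg_aug_of_hConnAvoid hbot hXc hXcl hx hy, hH.hConnAvoid_of_rtg_aug hbot hXc⟩

end Walk

end MultiGraph

end PercRepro
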